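import Summits.RiemannHypothesis.RiemannHypothesis.Theorems.JensenPolynomialsCapCertTable

/-!
# Route `JensenPolynomials` — `XiCumulantMajorantCap` kernel packaging, part 5: row identities of `rhoWinMin` in the scaled frame

RH-FREE, γ-FREE proof-of-data for the numeric route child `XiCumulantMajorantCap` (stmt-RiemannHypothesis-19217) of
route `JensenPolynomials` (rung J-P(P1′), cell rh-jensen, engine target ET1 «C2GEN-CERT»). Nothing here bears on the truth of RH.
`P_j = (d)_j/d^j ≤ P⁺_j/ONE`; `√(2d)·λ = d`; energy rows `(d)_jρ_HT/λ^j = √(d·P_j)`; window rows `= (6/5)(j−1)P_j`;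
bound rows 5/6 `= (4d+10)/d`, `(5d²+30d+8)/d²`; rows 2, 3, 4 `= 1, √((4d−2)/d), 3`.
-/

-- D-0017: `Summit.RiemannHypothesis.RiemannHypothesis.…` duplicates the namespace BY DESIGN (single-problem summit).
set_option linter.dupNamespace false

namespace Summit.RiemannHypothesis.RiemannHypothesis.Theorems.JensenPolynomials.CapCert

open Finset Real
open Summit.RiemannHypothesis.RiemannHypothesis.Theorems.JensenPolynomials
open Finset Real
open Summit.RiemannHypothesis.RiemannHypothesis.Theorems.JensenPolynomials

/-- `0 ≤ P_j ≤ 1` (`d > 0`). -/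
theorem Pr_facts {d : ℕ} (hd : 0 < d) (j : ℕ) : 0 ≤ Pr d j ∧ Pr d j ≤ 1 := by
  refine ⟨by unfold Pr; positivity, ?_⟩
  unfold Pr
  have hdj : (0 : ℝ) < (d : ℝ) ^ j := by positivity
  rw [div_le_one hdj]
  exact_mod_cast Nat.descFactorial_le_pow d j

/-- `P_{j+1} = P_j·(d−j)/d`. -/
theorem Pr_succ {d : ℕ} (hd : 0 < d) (j : ℕ) : Pr d (j + 1) = Pr d j * (((d - j : ℕ) : ℝ) / d) := by
  unfold Pr
  have hd' : (d : ℝ) ≠ 0 := by exact_mod_cast hd.ne'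
  rw [Nat.descFactorial_succ, Nat.cast_mul, pow_succ]
  field_simp

/-- `P_j ≤ P⁺_j/ONE` for `j ≥ 1`. -/
theorem Pr_le_PU {d : ℕ} (hd : 0 < d) : ∀ j, 1 ≤ j → Pr d j ≤ (PU d j : ℝ) / ONE := by
  intro j hj
  induction j, hj using Nat.le_induction with
  | base =>
    have : PU d 1 = ONE := rfl
    rw [this, div_self ONE_facts.2.1]
    exact (Pr_facts hd 1).2
  | succ j hj ih =>
    have hstep : PU d (j + 1) = cdiv (PU d j * (d - j)) d := by
      show (if j = 0 then ONE else cdiv (PU d j * (d - j)) d) = _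
      rw [if_neg (by omega)]
    rw [hstep, Pr_succ hd]
    have hc := div_le_cdiv (PU d j * (d - j)) d hd
    rw [le_div_iff₀ ONE_facts.1]
    refine le_trans ?_ hc
    have hdR : (0 : ℝ) < d := by exact_mod_cast hd
    rw [le_div_iff₀ hdR]
    push_cast
    have h0 : (0 : ℝ) ≤ ((d - j : ℕ) : ℝ) := Nat.cast_nonneg _
    have : Pr d j * ONE ≤ (PU d j : ℝ) := by rwa [le_div_iff₀ ONE_facts.1] at ih
    calc Pr d j * (((d - j : ℕ) : ℝ) / d) * ONE * d = (Pr d j * ONE) * ((d - j : ℕ) : ℝ) := by field_simp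
      _ ≤ (PU d j : ℝ) * ((d - j : ℕ) : ℝ) := mul_le_mul_of_nonneg_right this h0

/-- `√(2d)·λ = d`. -/
theorem sqrt_two_d_mul_lam (d : ℕ) : √(2 * (d : ℝ)) * lam d = d := by
  unfold lam
  rw [← Real.sqrt_mul (by positivity)]
  rw [show 2 * (d : ℝ) * ((d : ℝ) / 2) = (d : ℝ) ^ 2 by ring]
  exact Real.sqrt_sq (Nat.cast_nonneg d)

/-- `(2d)^{j/2}·λ^j = d^j`. -/
theorem rpow_two_d_mul_lam_pow (d j : ℕ) : (2 * (d : ℝ)) ^ ((j : ℝ) / 2) * lam d ^ j = (d : ℝ) ^ j := by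
  rw [rpow_half_eq_sqrt_pow (by positivity), ← mul_pow, sqrt_two_d_mul_lam]

/-- `W₁(j) ≥ 0` and `W₁(j)·λ^j = (d)_j ρ_winMin(d,j)` (`d ≥ 3`, `j ≥ 1`). -/
theorem W1r_nonneg {d : ℕ} (hd : 3 ≤ d) {j : ℕ} (hj : 1 ≤ j) :
    0 ≤ W1r d j ∧ W1r d j * lam d ^ j = (d.descFactorial j : ℝ) * rhoWinMin d j := by
  have hl : 0 < lam d ^ j := pow_pos (lam_facts hd).1 _
  unfold W1r
  exact ⟨div_nonneg (mul_nonneg (Nat.cast_nonneg _) (rhoWinMin_nonneg d j hd hj)) hl.le, div_mul_cancel₀ _ hl.ne'⟩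

/-- Term identity for the first sum. -/
theorem term1_eq {d : ℕ} (hd : 3 ≤ d) (j : ℕ) :
    (d.descFactorial j : ℝ) * cumulantCoeff (capFun d) j * rhoWinMin d j = W1r d j * et d j := by
  unfold W1r et
  have hl : lam d ^ j ≠ 0 := pow_ne_zero _ ((lam_facts hd).1).ne'
  field_simp

/-- Energy rows: `((d)_j·√((d−j)!/(2^j(d−1)!)) / λ^j)² = d·P_j` for `j ≤ d`. -/
theorem energy_sq {d j : ℕ} (hd : 3 ≤ d) (hjd : j ≤ d) :
    ((d.descFactorial j : ℝ) * √(((d - j).factorial : ℝ) / (2 ^ j * ((d - 1).factorial : ℝ))) / lam d ^ j) ^ 2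
      = (d : ℝ) * Pr d j := by
  have hq : (0 : ℝ) ≤ ((d - j).factorial : ℝ) / (2 ^ j * ((d - 1).factorial : ℝ)) := by positivity
  rw [div_pow, mul_pow, Real.sq_sqrt hq, ← pow_mul, show j * 2 = 2 * j by ring, pow_mul, (lam_facts hd).2]
  unfold Pr
  have h1 : ((d - j).factorial : ℝ) * (d.descFactorial j : ℝ) = (d.factorial : ℝ) := by
    exact_mod_cast Nat.factorial_mul_descFactorial hjd
  have h2 : (d : ℝ) * ((d - 1).factorial : ℝ) = (d.factorial : ℝ) := by
    exact_mod_cast Nat.mul_factorial_pred (by omega : d ≠ 0)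
  have hd0 : (d : ℝ) ≠ 0 := by have : (3:ℝ) ≤ d := by exact_mod_cast hd
                               linarith
  have hf : ((d - 1).factorial : ℝ) ≠ 0 := by positivity
  have key : (d.descFactorial j : ℝ) * ((d - j).factorial : ℝ) = (d : ℝ) * ((d - 1).factorial : ℝ) := by
    rw [mul_comm]; linarith [h1, h2]
  have h2j : (2 : ℝ) ^ j ≠ 0 := pow_ne_zero _ (by norm_num)
  have hdj : (d : ℝ) ^ j ≠ 0 := pow_ne_zero _ hd0
  rw [div_pow]
  rw [div_eq_iff (div_ne_zero hdj h2j)]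
  field_simp
  linear_combination ((d.descFactorial j : ℝ)) * key

/-- Energy rows in closed form: `(d)_j·ρ_HT(d,j)/λ^j = √(d·P_j)` (`5 ≤ j ≤ d`). -/
theorem energy_eq {d j : ℕ} (hd : 3 ≤ d) (hj : 5 ≤ j) (hjd : j ≤ d) :
    (d.descFactorial j : ℝ) * rhoHT d j / lam d ^ j = √((d : ℝ) * Pr d j) := by
  have hrho : rhoHT d j = √(((d - j).factorial : ℝ) / (2 ^ j * ((d - 1).factorial : ℝ))) := by
    unfold rhoHT
    rw [if_neg (by omega), if_neg (by omega), if_neg (by omega), if_neg (by omega)]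
  rw [hrho]
  have hx : 0 ≤ (d.descFactorial j : ℝ) * √(((d - j).factorial : ℝ) / (2 ^ j * ((d - 1).factorial : ℝ))) / lam d ^ j :=
    div_nonneg (mul_nonneg (Nat.cast_nonneg _) (Real.sqrt_nonneg _)) (pow_nonneg ((lam_facts hd).1).le _)
  rw [← Real.sqrt_sq hx, energy_sq hd hjd]

/-- `√(d·P) ≤ sqd⁺/ONE · sqrtTang⁺(P⁺)/ONE`. -/
theorem sqrt_dP_le {d : ℕ} (hd : 3 ≤ d) {j : ℕ} (hj : 1 ≤ j) :
    √((d : ℝ) * Pr d j) ≤ (mulU (sqdU d) (sqrtTangU (PU d j)) : ℝ) / ONE := by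
  have hd0 : 0 < d := by omega
  rw [Real.sqrt_mul (Nat.cast_nonneg d)]
  apply mulU_ge (Real.sqrt_nonneg _) (Real.sqrt_nonneg _)
  · unfold sqdU
    apply sqrtU_ge
    push_cast; rw [mul_div_assoc, div_self ONE_facts.2.1, mul_one]
  · exact sqrtTangU_ge ((Pr_facts hd0 j).1) (Pr_le_PU hd0 j hj)

/-- Window rows: `(d)_j·(6/5)(j−1)(2d)^{−j/2}/λ^j = (6/5)(j−1)·P_j`. -/
theorem window_eq (d j : ℕ) (hd : 3 ≤ d) :
    (d.descFactorial j : ℝ) * (6 / 5 * ((j : ℝ) - 1) / (2 * (d : ℝ)) ^ ((j : ℝ) / 2)) / lam d ^ j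
      = 6 / 5 * ((j : ℝ) - 1) * Pr d j := by
  unfold Pr
  have h := rpow_two_d_mul_lam_pow d j
  have hpos : 0 < (2 * (d : ℝ)) ^ ((j : ℝ) / 2) := Real.rpow_pos_of_pos (by positivity) _
  have hl : 0 < lam d ^ j := pow_pos ((lam_facts hd).1) _
  have hdj : (0 : ℝ) < (d : ℝ) ^ j := by positivity
  rw [← h]
  field_simp

/-- Row 5 bound-row value: `(d)_5·bndRow5(d)/((2d)^{5/2}λ⁵) = (4d+10)/d` (`d ≥ 8`). -/
theorem boundRow5_eq {d : ℕ} (hd : 8 ≤ d) :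
    (d.descFactorial 5 : ℝ) * (bndRow5 d / (2 * (d : ℝ)) ^ (((5 : ℕ) : ℝ) / 2)) / lam d ^ 5
      = (4 * (d : ℝ) + 10) / d := by
  have h := rpow_two_d_mul_lam_pow d 5
  have hdesc : (d.descFactorial 5 : ℝ) = d * (d - 1) * (d - 2) * (d - 3) * (d - 4) := by
    have h5 : d.descFactorial 5 = (d - 4) * ((d - 3) * ((d - 2) * ((d - 1) * (d * 1)))) := by
      simp [Nat.descFactorial_succ, Nat.descFactorial_zero]
    rw [h5]; push_cast [Nat.cast_sub (by omega : 4 ≤ d), Nat.cast_sub (by omega : 3 ≤ d),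
      Nat.cast_sub (by omega : 2 ≤ d), Nat.cast_sub (by omega : 1 ≤ d)]; ring
  have h8 : (8 : ℝ) ≤ d := by exact_mod_cast hd
  have h1 : (d : ℝ) - 1 ≠ 0 := by linarith
  have h2 : (d : ℝ) - 2 ≠ 0 := by linarith
  have h3 : (d : ℝ) - 3 ≠ 0 := by linarith
  have h4 : (d : ℝ) - 4 ≠ 0 := by linarith
  have hd0 : (d : ℝ) ≠ 0 := by linarith
  have hl : lam d ^ 5 ≠ 0 := pow_ne_zero _ ((lam_facts (by omega)).1).ne'
  have hp : (2 * (d : ℝ)) ^ (((5 : ℕ) : ℝ) / 2) ≠ 0 := (Real.rpow_pos_of_pos (by positivity) _).ne'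
  have hl5 : lam d ^ 5 = (d : ℝ) ^ 5 / (2 * (d : ℝ)) ^ (((5 : ℕ) : ℝ) / 2) := by
    rw [eq_div_iff hp]; linarith [h]
  rw [hdesc, hl5]
  unfold bndRow5
  field_simp

/-- Row 6 bound-row value: `(d)_6·bndRow6(d)/((2d)^{3}λ⁶) = (5d²+30d+8)/d²` (`d ≥ 9`). -/
theorem boundRow6_eq {d : ℕ} (hd : 9 ≤ d) :
    (d.descFactorial 6 : ℝ) * (bndRow6 d / (2 * (d : ℝ)) ^ (((6 : ℕ) : ℝ) / 2)) / lam d ^ 6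
      = (5 * (d : ℝ) ^ 2 + 30 * d + 8) / (d : ℝ) ^ 2 := by
  have h := rpow_two_d_mul_lam_pow d 6
  have hdesc : (d.descFactorial 6 : ℝ) = d * (d - 1) * (d - 2) * (d - 3) * (d - 4) * (d - 5) := by
    have h6 : d.descFactorial 6 = (d - 5) * ((d - 4) * ((d - 3) * ((d - 2) * ((d - 1) * (d * 1))))) := by
      simp [Nat.descFactorial_succ, Nat.descFactorial_zero]
    rw [h6]; push_cast [Nat.cast_sub (by omega : 5 ≤ d), Nat.cast_sub (by omega : 4 ≤ d),
      Nat.cast_sub (by omega : 3 ≤ d), Nat.cast_sub (by omega : 2 ≤ d), Nat.cast_sub (by omega : 1 ≤ d)]; ring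
  have h9 : (9 : ℝ) ≤ d := by exact_mod_cast hd
  have h1 : (d : ℝ) - 1 ≠ 0 := by linarith
  have h2 : (d : ℝ) - 2 ≠ 0 := by linarith
  have h3 : (d : ℝ) - 3 ≠ 0 := by linarith
  have h4 : (d : ℝ) - 4 ≠ 0 := by linarith
  have h5 : (d : ℝ) - 5 ≠ 0 := by linarith
  have hd0 : (d : ℝ) ≠ 0 := by linarith
  have hl : lam d ^ 6 ≠ 0 := pow_ne_zero _ ((lam_facts (by omega)).1).ne'
  have hp : (2 * (d : ℝ)) ^ (((6 : ℕ) : ℝ) / 2) ≠ 0 := (Real.rpow_pos_of_pos (by positivity) _).ne'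
  have hl6 : lam d ^ 6 = (d : ℝ) ^ 6 / (2 * (d : ℝ)) ^ (((6 : ℕ) : ℝ) / 2) := by
    rw [eq_div_iff hp]; linarith [h]
  rw [hdesc, hl6]
  unfold bndRow6
  field_simp

/-- Rows 2, 3, 4 in the scaled frame: `W₁(2) = 1`, `W₁(3)² = (4d−2)/d`, and `W₁(4) = 3` (the last for `d ≥ 4`). -/
theorem W1r_low_rows {d : ℕ} (hd : 3 ≤ d) :
    W1r d 2 = 1 ∧ W1r d 3 ^ 2 = (4 * (d : ℝ) - 2) / d ∧ (4 ≤ d → W1r d 4 = 3) := by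
  refine ⟨?_, ?_, fun hd4 => ?_⟩
  ·
    unfold W1r rhoWinMin rhoHT
    simp only [show (2:ℕ) ≤ 4 from by norm_num, if_true, show ¬ (2:ℕ) ≤ 1 from by norm_num, if_false]
    have hdesc : (d.descFactorial 2 : ℝ) = d * (d - 1) := by
      have : d.descFactorial 2 = (d - 1) * (d * 1) := by simp [Nat.descFactorial_succ, Nat.descFactorial_zero]
      rw [this]; push_cast [Nat.cast_sub (by omega : 1 ≤ d)]; ring
    rw [hdesc, (lam_facts hd).2]
    have h3 : (3 : ℝ) ≤ d := by exact_mod_cast hd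
    have h1 : (d : ℝ) - 1 ≠ 0 := by linarith
    have hd0 : (d : ℝ) ≠ 0 := by linarith
    field_simp
  ·
    unfold W1r rhoWinMin rhoHT
    simp only [show (3:ℕ) ≤ 4 from by norm_num, if_true, show ¬ (3:ℕ) ≤ 1 from by norm_num, if_false,
      show (3:ℕ) ≠ 2 from by norm_num]
    have hdesc : (d.descFactorial 3 : ℝ) = d * (d - 1) * (d - 2) := by
      have : d.descFactorial 3 = (d - 2) * ((d - 1) * (d * 1)) := by simp [Nat.descFactorial_succ, Nat.descFactorial_zero]
      rw [this]; push_cast [Nat.cast_sub (by omega : 2 ≤ d), Nat.cast_sub (by omega : 1 ≤ d)]; ring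
    rw [hdesc]
    have h3 : (3 : ℝ) ≤ d := by exact_mod_cast hd
    have h1 : (d : ℝ) - 1 ≠ 0 := by linarith
    have h2 : (d : ℝ) - 2 ≠ 0 := by linarith
    have hd0 : (d : ℝ) ≠ 0 := by linarith
    have hs : √(2 * (d : ℝ) - 1) ^ 2 = 2 * (d : ℝ) - 1 := Real.sq_sqrt (by linarith)
    have hl3 : (lam d ^ 3) ^ 2 = ((d : ℝ) / 2) ^ 3 := by rw [← pow_mul, show 3 * 2 = 2 * 3 by ring, pow_mul, (lam_facts hd).2]
    rw [div_pow, mul_pow, div_pow, hs, hl3]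
    field_simp
    ring
  ·
    unfold W1r rhoWinMin rhoHT
    simp only [le_refl, if_true, show ¬ (4:ℕ) ≤ 1 from by norm_num, if_false, show (4:ℕ) ≠ 2 from by norm_num,
      show (4:ℕ) ≠ 3 from by norm_num]
    have hdesc : (d.descFactorial 4 : ℝ) = d * (d - 1) * (d - 2) * (d - 3) := by
      have : d.descFactorial 4 = (d - 3) * ((d - 2) * ((d - 1) * (d * 1))) := by
        simp [Nat.descFactorial_succ, Nat.descFactorial_zero]
      rw [this]; push_cast [Nat.cast_sub (by omega : 3 ≤ d), Nat.cast_sub (by omega : 2 ≤ d), Nat.cast_sub (by omega : 1 ≤ d)]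
      ring
    have hl4 : lam d ^ 4 = ((d : ℝ) / 2) ^ 2 := by rw [show (4:ℕ) = 2 * 2 by ring, pow_mul, (lam_facts hd).2]
    rw [hdesc, hl4]
    have h4 : (4 : ℝ) ≤ d := by exact_mod_cast hd4
    have h1 : (d : ℝ) - 1 ≠ 0 := by linarith
    have h2 : (d : ℝ) - 2 ≠ 0 := by linarith
    have h3 : (d : ℝ) - 3 ≠ 0 := by linarith
    have hd0 : (d : ℝ) ≠ 0 := by linarith
    field_simp
    ring

end Summit.RiemannHypothesis.RiemannHypothesis.Theorems.JensenPolynomials.CapCert
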